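import Mathlib
import Literature.Computability.AlgebraicComplexity.NestFreeMatchingFifo
import Summits.ValiantsHypothesis.ValiantsHypothesis.Theorems.FifoMatchingNNMonotoneHardRank
import HarnessLib

/-!
# Crux `NNLinearDegreeCofactorHard` (stmt-ValiantsHypothesis-23918), line `internal_cofactor`, stub S2b:
# a cut inside a defect run is respected as soon as the run out-pops the queue (adversary α, deterministic)

Stub S2b is, in kernel, a statement about ONE probability weighting of the nest-free perfect matchings of
`[2n]` per defect set `R` (`…DefectSplitReduction.denseInternalHard_of_defect_spread_measures`, p591196; or p3's
`denseInternalHard_of_avoidingSpread`): every balanced `I ⊆ Rᶜ` must be respected OFF `R`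
(`∀ i ∉ R, M i ∉ R → (i ∈ I ↔ M i ∈ I)`) only with tiny mass.  Every candidate so far is a QUEUE-WORD measure: the
law of the FIFO pairing `fifo W` of a random ballot word `W` (landed: `Literature/…/NestFreeMatchingFifo.lean`,
`Theorems/FifoMatchingNNMonotoneHardMeasure.lean`).  This file records, as a deterministic lemma about ANY ballot
word, the first test such a measure must pass (adversary α of the workfile
`Cruxes/NNLinearDegreeCofactorHard/Lines/internal_cofactor-S2b-measure-constraints.md`):

* `closer_lt_of_card_le` — if the closers before `u'` are at least as many as the openers before `u`, every arc
  opened before `u` is closed before `u'` (FIFO closes the oldest arc first);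
* `cut_respected_off_run` — hence, if `[u, u') ⊆ R` (a run of defects) and
  `#openers<u ≤ #closers<u'` — equivalently (`card_le_of_height_le`) the closers INSIDE the run are at least the
  queue height `#openers<u − #closers<u` at its start — then EVERY arc of `fifo W` with both ends outside `R` has
  both ends `< u` or both ends `≥ u`: the cut at `u` is respected off `R`;
* `cut_respected_off_run'` — the same for the split `I := {i < u} ∖ R` in the literal form of the S2b event.

Consequence (not formalised here, see the workfile): the landed uniform thick queue (height `L ± m`, uniform
letters on `R`) gives mass `≥ 1 − (band failure)` to this event as soon as `R` contains a run of length
`≥ 2L + 2m + 2` in the middle — a defect-robust measure needs height `> #closers(run)` at every run.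

Honest framing: elementary bookkeeping on words; stub S2b, the crux, `NNDivisionHard`, `NNNotVP` stay OPEN and
VP ≠ VNP is not touched.  No definitions, no named facts.
-/

noncomputable section

-- Sub = Summit single-conjunct layout: the duplicated namespace component is mandated by the tree.
set_option linter.dupNamespace false

namespace Summit.ValiantsHypothesis.ValiantsHypothesis.Theorems.FifoMatching.NNLinearDegreeCofactorHard.RunCut

open Finset Literature.Computability.AlgebraicComplexity
open Summit.ValiantsHypothesis.ValiantsHypothesis.Theorems.FifoMatching.NNMonotoneHard

variable {M : ℕ} {W : Fin M → Bool} {h : (closerSet W).card = (openerSet W).card}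

/-- **FIFO closes the oldest arc first**: if `#openers<u ≤ #closers<u'`, then the arc of every opener before `u`
is closed before `u'` (the `k`-th opener is before `u` iff `k < #openers<u`, and then `k < #closers<u'`, i.e. the
`k`-th closer is before `u'`). [folklore] -/
theorem closer_lt_of_card_le {u u' : Fin M}
    (hcount : ((openerSet W).filter fun i => i < u).card ≤ ((closerSet W).filter fun i => i < u').card)
    (k : Fin (openerSet W).card) (hk : (openerSet W).orderEmbOfFin rfl k < u) :
    (closerSet W).orderEmbOfFin h k < u' := by
  rw [orderEmbOfFin_lt_iff] at hk ⊢
  exact lt_of_lt_of_le hk hcount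

/-- The count hypothesis from the queue height: if `u ≤ u'` and the closers in `[u, u')` are at least
`#openers<u − #closers<u` (the number of arcs open at time `u`), then `#openers<u ≤ #closers<u'`. [folklore] -/
theorem card_le_of_height_le {u u' : Fin M} (huu' : u ≤ u')
    (hh : ((openerSet W).filter fun i => i < u).card - ((closerSet W).filter fun i => i < u).card ≤
      ((closerSet W).filter fun i => u ≤ i ∧ i < u').card) :
    ((openerSet W).filter fun i => i < u).card ≤ ((closerSet W).filter fun i => i < u').card := by
  classical
  have hsplit : ((closerSet W).filter fun i => i < u') =
      ((closerSet W).filter fun i => i < u) ∪ ((closerSet W).filter fun i => u ≤ i ∧ i < u') := by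
    ext i
    simp only [mem_filter, mem_union]
    constructor
    · rintro ⟨hi, hlt⟩
      by_cases hiu : i < u
      · exact Or.inl ⟨hi, hiu⟩
      · exact Or.inr ⟨hi, not_lt.1 hiu, hlt⟩
    · rintro (⟨hi, hlt⟩ | ⟨hi, -, hlt⟩)
      · exact ⟨hi, lt_of_lt_of_le hlt huu'⟩
      · exact ⟨hi, hlt⟩
  have hdisj : Disjoint ((closerSet W).filter fun i => i < u)
      ((closerSet W).filter fun i => u ≤ i ∧ i < u') := by
    rw [disjoint_left]
    intro i hi hi'
    rw [mem_filter] at hi hi'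
    exact absurd hi.2 (not_lt.2 hi'.2.1)
  rw [hsplit, card_union_of_disjoint hdisj]
  omega

/-- **Adversary α: a defect run that out-pops the queue makes its cut respected off the defects.**  Let `W` be a
ballot word, `[u, u') ⊆ R`, and `#openers<u ≤ #closers<u'`.  Then every arc of the FIFO pairing with both endpoints
outside `R` lies entirely before `u` or entirely at/after `u`:
`∀ i ∉ R, fifo W i ∉ R → (i < u ↔ fifo W i < u)`.  Proof: an arc `(o_k, c_k)` with `o_k < u` has `c_k < u'`
(`closer_lt_of_card_le`), so `c_k < u` or `c_k ∈ [u, u') ⊆ R`; and `c_k < u ⇒ o_k < c_k < u` (ballot).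
[folklore] -/
theorem cut_respected_off_run (hb : IsBallot W h) (R : Finset (Fin M)) {u u' : Fin M}
    (hrun : ∀ i : Fin M, u ≤ i → i < u' → i ∈ R)
    (hcount : ((openerSet W).filter fun i => i < u).card ≤ ((closerSet W).filter fun i => i < u').card) :
    ∀ i : Fin M, i ∉ R → fifo W h i ∉ R → (i < u ↔ fifo W h i < u) := by
  have key : ∀ k : Fin (openerSet W).card, (closerSet W).orderEmbOfFin h k ∉ R →
      ((openerSet W).orderEmbOfFin rfl k < u ↔ (closerSet W).orderEmbOfFin h k < u) := by
    intro k hcR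
    constructor
    · intro hok
      have hcu' := closer_lt_of_card_le (h := h) hcount k hok
      by_contra hcu
      exact hcR (hrun _ (not_lt.1 hcu) hcu')
    · intro hck
      exact lt_trans (hb k) hck
  intro i hiR hfR
  by_cases hi : W i = true
  · obtain ⟨k, rfl⟩ := exists_eq_opener hi
    rw [fifo_opener] at hfR ⊢
    exact key k hfR
  · obtain ⟨k, rfl⟩ := exists_eq_closer h (Bool.eq_false_iff.2 hi)
    rw [fifo_closer] at hfR ⊢
    exact (key k hiR).symm

/-- **Adversary α in the literal form of the S2b event.**  Under the hypotheses of `cut_respected_off_run`, the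
split `I := {i : i < u ∧ i ∉ R}` of `Rᶜ` is respected off `R` by `fifo W`:
`∀ i ∉ R, fifo W i ∉ R → (i ∈ I ↔ fifo W i ∈ I)`. [folklore] -/
theorem cut_respected_off_run' (hb : IsBallot W h) (R : Finset (Fin M)) {u u' : Fin M}
    (hrun : ∀ i : Fin M, u ≤ i → i < u' → i ∈ R)
    (hcount : ((openerSet W).filter fun i => i < u).card ≤ ((closerSet W).filter fun i => i < u').card) :
    ∀ i : Fin M, i ∉ R → fifo W h i ∉ R →
      (i ∈ (univ.filter fun j : Fin M => j < u ∧ j ∉ R) ↔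
        fifo W h i ∈ (univ.filter fun j : Fin M => j < u ∧ j ∉ R)) := by
  intro i hiR hfR
  simp only [mem_filter, mem_univ, true_and]
  rw [cut_respected_off_run hb R hrun hcount i hiR hfR]
  exact ⟨fun hh => ⟨hh.1, hfR⟩, fun hh => ⟨hh.1, hiR⟩⟩

end Summit.ValiantsHypothesis.ValiantsHypothesis.Theorems.FifoMatching.NNLinearDegreeCofactorHard.RunCut

end
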